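import Literature.NumberTheory.Sieve.BatemanHornMertensProduct
import Mathlib.NumberTheory.AlmostPrime
import HarnessLib

/-!
# Almost-prime values of a Bateman–Horn system, uniformly in the system

Topic `Literature/NumberTheory/Sieve` (next to `AletheiaZomleferFukshanskyGarcia2020ApplicationsBrunSieveProofs`
— the Brun-sieve UPPER bound `polyPrimeCount_le_brunSieve_holds` for Bateman–Horn systems — and
`BatemanHornMertensProduct.lean`). Everything in this file is PROVED (theorems only: no named
fact, no new definition, no `sorry`).

Let `f = (f₁, …, f_k)` be a Bateman–Horn system (`IsBatemanHornSystem f`) with `deg fᵢ = dᵢ`,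
`F = ∏ fᵢ` of degree `G = ∑ dᵢ`, and `C(f) = batemanHornConst f = ∏_p (1 − 1/p)^{−k}(1 − ω_f(p)/p)`.
Diamond–Halberstam–Galway, *A Higher-Dimensional Sieve Method*, §11.5 treat the sequence
`𝒜 = {F(n) : 1 ≤ n ≤ x}` ("`κ = g`, … since `H(n) = O_H(n^G)` we may take `μ₀` to be any constant
larger than `G`") and show that `F(n)` is a `P_r` — has at most `r` prime factors counted with
multiplicity — for `≫ C(f) x/(log x)^k` integers `n ≤ x`, for every `r` exceeding the right-hand
side of (11.24) (Halberstam–Richert, *Sieve Methods*, Thm. 10.4). This file proves the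
qualitative form of that statement, with `r = r(k, d)` and the implied constant `c = c(k) > 0`
depending on `k` and the degree vector `d` ONLY (not on the system):

* **`BatemanHornAlmostPrimes.batemanHorn_almostPrimes`** — for every `k` and `d : Fin k → ℕ`
  there are `r : ℕ` and `c > 0` such that for every Bateman–Horn system `f` of `k` polynomials
  with `deg fᵢ = dᵢ`, for all sufficiently large `x`,
  `c · C(f) · x/(log x)^k ≤ #{n ≤ x : ∏ fᵢ(n) ≠ 0 ∧ Ω(|∏ fᵢ(n)|) ≤ r}`
  (the count is spelled with Mathlib's `Nat.IsAtMostAlmostPrime r m ↔ m ≠ 0 ∧ Ω m ≤ r`).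

The proof is the crude one through the Fundamental Lemma (the source's (11.24) gives the sharp
admissible `r` through the Diamond–Halberstam–Richert sieve, which the tree does not have in
dimension `κ > 1`): shift to `F(t) = ∏ fᵢ(t + n₀)` with all `fᵢ(n) ≥ 1` for `n ≥ n₀`; the values
`F(m)`, `1 ≤ m ≤ N = x − n₀`, form the tree's sifted sequence `polyAPSeq F N 1 0` with density
`ω_f(p)/p`, of sieve dimension `2G` with a constant depending on `G` only
(`PolyPrimeCountBrun.hasSieveDimension_rootDensity_of_le`), and remainders `|R_m| ≤ ω_F(m) ≤ m`;
the uniform Fundamental Lemma (`SieveSequence.fundamental_lemma_uniform_holds`) at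
`z ≈ x^{1/(4s)}`, level `z^s`, with `s = s(k, d)` so large that `C_FL e^{−s} ≤ 1/2`, gives
`S(𝒜, z) ≥ N V(z)/2 − 4^s x^{1/2}`; Mertens' theorem along the system
(`BatemanHornMertens.tendsto_log_pow_mul_prod_one_sub_rootCount`:
`(log z)^k V(z) → C(f) e^{−kγ}`) gives `V(z) ≥ C(f) e^{−kγ}/(2 (log x)^k)` for large `x`; and an
`x^{1/(4s)}`-rough value `F(m) ≤ x^{G+1}` has `Ω(F(m)) ≤ 4s(G+1) =: r`. Hence the bound with
`c = e^{−kγ}/16`.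
TODO(general form): the admissible `r` of (11.24), e.g. `r = 5` for two and `r = 9` for three
linear forms (Example 11.3; the tree's `DiamondHalberstam1997_twoLinear_P5_holds` is the case of two
linear forms).

## References
* H. G. Diamond, H. Halberstam, W. F. Galway, *A Higher-Dimensional Sieve Method*, Cambridge Tracts
  in Mathematics 177, CUP (2008): §11.5 (11.24)–(11.26) and Example 11.3 (PDF p. 107).
  [DiamondHalberstamGalway2008]
* H. Halberstam, H.-E. Richert, *Sieve Methods*, Academic Press (1974), Thm. 10.4.
  [HalberstamRichert1974]
-/

open Finset Filter Topology Polynomial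
open scoped ArithmeticFunction.Omega

namespace Literature.NumberTheory.Sieve

namespace BatemanHornAlmostPrimes

open PolyPrimeCountBrun

/-! ### Two elementary lemmas -/

/-- Size of a polynomial value: `|P(m)| ≤ (∑ᵢ |aᵢ|) m^{deg P}` for an integer `m ≥ 1`. [folklore] -/
private theorem abs_eval_natCast_le (P : ℤ[X]) {m : ℕ} (hm : 1 ≤ m) :
    |P.eval (m : ℤ)| ≤ (∑ i ∈ range (P.natDegree + 1), |P.coeff i|) * (m : ℤ) ^ P.natDegree := by
  rw [eval_eq_sum_range, sum_mul]
  refine (abs_sum_le_sum_abs _ _).trans (sum_le_sum fun i hi => ?_)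
  rw [mem_range] at hi
  rw [abs_mul, abs_pow, abs_of_nonneg (by positivity : (0 : ℤ) ≤ (m : ℤ))]
  exact mul_le_mul_of_nonneg_left
    (pow_le_pow_right₀ (by exact_mod_cast hm) (by omega)) (abs_nonneg _)

/-- A `z`-rough number is a `P_r` with `z^r ≤ n`: if `n ≠ 0` and every prime factor of `n` is
`≥ z`, then `z^{Ω(n)} ≤ n`. [folklore] -/
private theorem pow_cardFactors_le {n z : ℕ} (hn : n ≠ 0)
    (h : ∀ p : ℕ, p.Prime → p ∣ n → z ≤ p) : z ^ Ω n ≤ n := by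
  rw [ArithmeticFunction.cardFactors_apply]
  calc z ^ n.primeFactorsList.length ≤ n.primeFactorsList.prod :=
        List.pow_card_le_prod _ _ fun p hp =>
          h p (Nat.prime_of_mem_primeFactorsList hp) (Nat.dvd_of_mem_primeFactorsList hp)
    _ = n := Nat.prod_primeFactorsList hn

/-! ### The theorem -/

open scoped Classical in
/-- **Almost-prime values of a Bateman–Horn system, uniformly in the system.** For every `k` and
every degree vector `d : Fin k → ℕ` there are `r = r(k, d) ∈ ℕ` and `c = c(k) > 0` such that for
every Bateman–Horn system `f` of `k` integer polynomials with `deg fᵢ = dᵢ`,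
`#{n ≤ x : ∏ fᵢ(n) ≠ 0 ∧ Ω(|∏ fᵢ(n)|) ≤ r} ≥ c · C(f) · x/(log x)^k` for all sufficiently large `x`
(`C(f) = batemanHornConst f`). The source proves this for every `r` exceeding the right-hand side
of its (11.24) (weighted sieve of dimension `κ = g`); proved here, by the Fundamental Lemma, with
`r = 4s(∑ dᵢ + 1)` for an `s = s(k, d)` and `c = e^{−kγ}/16` (see the module docstring).
[cite: DiamondHalberstamGalway2008, §11.5 (11.24) (PDF p. 107)] -/
theorem batemanHorn_almostPrimes (k : ℕ) (d : Fin k → ℕ) :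
    ∃ r : ℕ, ∃ c : ℝ, 0 < c ∧
      ∀ f : Fin k → ℤ[X], IsBatemanHornSystem f → (∀ i, (f i).natDegree = d i) →
        ∀ᶠ x : ℕ in atTop,
          c * batemanHornConst f * (x : ℝ) / Real.log x ^ k ≤
            (#((range (x + 1)).filter fun n : ℕ =>
                (∏ i, (f i).eval (n : ℤ)) ≠ 0 ∧
                  Nat.IsAtMostAlmostPrime r (∏ i, (f i).eval (n : ℤ)).natAbs) : ℝ) := by
  -- constants depending on `k` and `d` only
  set D : ℕ := ∑ i, d i with hD
  set κ : ℝ := 2 * (D : ℝ) with hκ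
  set K : ℝ := ((2 * D + 1 : ℕ) : ℝ) ^ (2 * D + 1) * Real.exp (2 * D * (9 / 2 + 6 / Real.log 2))
    with hK
  obtain ⟨CFL, hCFL0, hFL⟩ := SieveSequence.fundamental_lemma_uniform_holds κ K
  set s : ℕ := ⌈Real.log (2 * CFL)⌉₊ + 1 with hs
  have hs1 : 1 ≤ s := by omega
  have hsR : Real.log (2 * CFL) ≤ (s : ℝ) := by
    rw [hs]; push_cast
    linarith [Nat.le_ceil (Real.log (2 * CFL))]
  have hexp_s : CFL * Real.exp (-(s : ℝ)) ≤ 1 / 2 := by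
    have h1 : Real.exp (-(s : ℝ)) ≤ Real.exp (-Real.log (2 * CFL)) :=
      Real.exp_le_exp.mpr (by linarith)
    rw [Real.exp_neg (Real.log (2 * CFL)), Real.exp_log (by positivity)] at h1
    calc CFL * Real.exp (-(s : ℝ)) ≤ CFL * (2 * CFL)⁻¹ := mul_le_mul_of_nonneg_left h1 hCFL0.le
      _ = 1 / 2 := by field_simp
  set e : ℝ := 1 / (4 * (s : ℝ)) with he
  have he0 : 0 < e := by positivity
  have he1 : e ≤ 1 := by
    rw [he, div_le_one (by positivity)]
    have : (1 : ℝ) ≤ s := by exact_mod_cast hs1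
    linarith
  set r : ℕ := 4 * s * (D + 1) with hr
  set c : ℝ := Real.exp (-((k : ℝ) * Real.eulerMascheroniConstant)) / 16 with hc
  have hc0 : 0 < c := by positivity
  refine ⟨r, c, hc0, ?_⟩
  intro f hf hdeg
  -- the Bateman–Horn constant `C = C(f) > 0`
  have hbh := IsBatemanHornSystem.hasBatemanHornConst_holds hf
  set C : ℝ := batemanHornConst f with hCdef
  have hCpos : 0 < C := hbh.2
  set γk : ℝ := Real.exp (-((k : ℝ) * Real.eulerMascheroniConstant)) with hγk
  have hγk0 : 0 < γk := Real.exp_pos _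
  -- degrees
  have hdpos' : ∀ i, 0 < (f i).natDegree := hf.natDegree_pos
  -- `n₀`: all `fᵢ(n) ≥ 1` for `n ≥ n₀`
  have hn₀i : ∀ i, ∃ N₀ : ℕ, ∀ n : ℕ, N₀ ≤ n → 1 ≤ (f i).eval (n : ℤ) := by
    intro i
    obtain ⟨N₀, hN₀⟩ := Literature.Barriers.Parity.exists_forall_le_eval_of_leadingCoeff_pos
      (hdpos' i) (hf.leadingCoeff_pos i) 1
    exact ⟨N₀, fun n hn => by exact_mod_cast hN₀ n hn⟩
  choose N₀ hN₀ using hn₀i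
  set n₀ : ℕ := Finset.univ.sup N₀ with hn₀_def
  have hn₀ : ∀ i, ∀ n : ℕ, n₀ ≤ n → 1 ≤ (f i).eval (n : ℤ) := fun i n hn =>
    hN₀ i n ((Finset.le_sup (f := N₀) (mem_univ i)).trans hn)
  -- the shifted product polynomial
  set G : ℤ[X] := ∏ i, f i with hG
  set F : ℤ[X] := G.comp (X + Polynomial.C (n₀ : ℤ)) with hF
  have hFeval : ∀ m : ℕ, F.eval (m : ℤ) = ∏ i, (f i).eval ((m : ℤ) + n₀) := fun m => by
    simp [hF, hG, eval_comp, eval_prod]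
  have hρF : ∀ p, polyRootCountMod ![F] p = polyRootCountMod f p := fun p => by
    rw [hF, Literature.Barriers.Parity.polyRootCountMod_comp_X_add_C, hG,
      ← polyRootCountMod_eq_single_prod]
  have hρlt : ∀ p, p.Prime → polyRootCountMod ![F] p < p := fun p hp => by
    rw [hρF]; exact hf.hasNoFixedPrimeDivisor p hp
  have hρle : ∀ p, p.Prime → polyRootCountMod ![F] p ≤ D := fun p hp => by
    rw [hρF p, polyRootCountMod_eq_single_prod]
    refine (polyRootCountMod_single_le_natDegree_of_lt hp ?_).trans ?_
    · rw [← polyRootCountMod_eq_single_prod]; exact hf.hasNoFixedPrimeDivisor p hp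
    · refine (natDegree_prod_le _ _).trans (le_of_eq ?_)
      rw [hD]
      exact sum_congr rfl fun i _ => hdeg i
  have hdim : HasSieveDimension (rootDensity F) κ K := hasSieveDimension_rootDensity_of_le hρle hρlt
  have hFpos : ∀ m : ℕ, 0 < F.eval (m : ℤ) := fun m => by
    rw [hFeval]
    exact prod_pos fun i _ => by
      have := hn₀ i (m + n₀) (Nat.le_add_left _ _)
      push_cast at this
      linarith
  -- `deg F ≤ D` and the size of the values
  have hGdeg : G.natDegree ≤ D := by
    rw [hG]
    refine (natDegree_prod_le _ _).trans (le_of_eq ?_)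
    rw [hD]
    exact sum_congr rfl fun i _ => hdeg i
  have hFdeg : F.natDegree ≤ D := by
    rw [hF]
    refine natDegree_comp_le.trans ?_
    rw [natDegree_X_add_C, mul_one]
    exact hGdeg
  set B : ℤ := ∑ i ∈ range (F.natDegree + 1), |F.coeff i| with hB
  have hB0 : 0 ≤ B := sum_nonneg fun i _ => abs_nonneg _
  have hsize : ∀ m x : ℕ, 1 ≤ m → m ≤ x →
      (((F.eval (m : ℤ)).natAbs : ℕ) : ℤ) ≤ B * (x : ℤ) ^ D := by
    intro m x hm hmx
    rw [Int.natCast_natAbs]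
    have hx1 : (1 : ℤ) ≤ x := by exact_mod_cast hm.trans hmx
    calc |F.eval (m : ℤ)| ≤ B * (m : ℤ) ^ F.natDegree := abs_eval_natCast_le F hm
      _ ≤ B * (x : ℤ) ^ F.natDegree := by
          gcongr
      _ ≤ B * (x : ℤ) ^ D := mul_le_mul_of_nonneg_left (pow_le_pow_right₀ hx1 hFdeg) hB0
  -- eventualities in `x`
  have ha_tend : Tendsto (fun x : ℕ => (x : ℝ) ^ e) atTop atTop :=
    (tendsto_rpow_atTop he0).comp tendsto_natCast_atTop_atTop
  have hy_tend : Tendsto (fun x : ℕ => ⌊(x : ℝ) ^ e⌋₊) atTop atTop :=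
    tendsto_nat_floor_atTop.comp ha_tend
  have E1 : ∀ᶠ x : ℕ in atTop, C * γk / 2 ≤
      Real.log ((⌊(x : ℝ) ^ e⌋₊ : ℕ) : ℝ) ^ k *
        ∏ p ∈ Nat.primesLE ⌊(x : ℝ) ^ e⌋₊, (1 - (polyRootCountMod f p : ℝ) / p) := by
    have h := BatemanHornMertens.tendsto_log_pow_mul_prod_one_sub_rootCount hf
    have hlt : C * γk / 2 < batemanHornConst f * γk := by
      rw [← hCdef]
      have : 0 < C * γk := mul_pos hCpos hγk0
      linarith
    exact hy_tend.eventually (h.eventually_const_le hlt)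
  have Ea : ∀ᶠ x : ℕ in atTop, (4 : ℝ) ≤ (x : ℝ) ^ e := ha_tend.eventually_ge_atTop 4
  set Kf : ℝ := (4 : ℝ) ^ s with hKf
  have hKf0 : 0 < Kf := by positivity
  have E3 : ∀ᶠ x : ℕ in atTop, Kf * (x : ℝ) ^ (1 / 2 : ℝ) ≤ c * C * ((x : ℝ) / Real.log x ^ k) := by
    have hcC : 0 < c * C := mul_pos hc0 hCpos
    have hlo := isLittleO_log_rpow_rpow_atTop (k : ℝ) (by norm_num : (0 : ℝ) < 1 / 2)
    have hev := hlo.def (div_pos hcC hKf0)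
    have hreal : ∀ᶠ x : ℝ in atTop, Kf * x ^ (1 / 2 : ℝ) ≤ c * C * (x / Real.log x ^ k) := by
      filter_upwards [hev, eventually_gt_atTop (1 : ℝ)] with x hx hx1
      have hx0 : 0 < x := by linarith
      have hlog : 0 < Real.log x := Real.log_pos hx1
      rw [Real.norm_of_nonneg (Real.rpow_nonneg hlog.le _),
        Real.norm_of_nonneg (Real.rpow_nonneg hx0.le _), Real.rpow_natCast] at hx
      have hsq : x ^ (1 / 2 : ℝ) * x ^ (1 / 2 : ℝ) = x := by
        rw [← Real.rpow_add hx0]; norm_num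
      rw [mul_div_assoc', le_div_iff₀ (pow_pos hlog k)]
      have h1 : Kf * Real.log x ^ k ≤ c * C * x ^ (1 / 2 : ℝ) := by
        have := mul_le_mul_of_nonneg_left hx hKf0.le
        have e' : Kf * (c * C / Kf * x ^ (1 / 2 : ℝ)) = c * C * x ^ (1 / 2 : ℝ) := by
          field_simp
        linarith
      calc Kf * x ^ (1 / 2 : ℝ) * Real.log x ^ k = x ^ (1 / 2 : ℝ) * (Kf * Real.log x ^ k) := by
            ring
        _ ≤ x ^ (1 / 2 : ℝ) * (c * C * x ^ (1 / 2 : ℝ)) :=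
            mul_le_mul_of_nonneg_left h1 (Real.rpow_nonneg hx0.le _)
        _ = c * C * x := by rw [← mul_assoc, mul_comm _ (c * C), mul_assoc, hsq]
    exact tendsto_natCast_atTop_atTop.eventually hreal
  filter_upwards [E1, Ea, E3, eventually_ge_atTop (2 * n₀ + 2), eventually_ge_atTop B.toNat]
    with x h1 ha4 h3 hxn₀ hxB
  -- parameters at height `x`
  set N : ℕ := x - n₀ with hN
  have hN2 : (x : ℝ) ≤ 2 * N := by
    have : x ≤ 2 * N := by omega
    exact_mod_cast this
  have hx0 : (0 : ℝ) < x := by exact_mod_cast (show 0 < x by omega)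
  have hx1 : (1 : ℝ) ≤ x := by exact_mod_cast (show 1 ≤ x by omega)
  set a : ℝ := (x : ℝ) ^ e with ha
  set y : ℕ := ⌊a⌋₊ with hy
  set zN : ℕ := y + 1 with hzN
  set z : ℝ := (zN : ℝ) with hz
  have ha0 : 0 ≤ a := by linarith
  have hy4 : 4 ≤ y := Nat.le_floor (by exact_mod_cast ha4)
  have hya : (y : ℝ) ≤ a := Nat.floor_le ha0
  have haz : a < z := by rw [hz, hzN]; push_cast; exact Nat.lt_floor_add_one a
  have hz2 : (2 : ℝ) ≤ z := by rw [hz, hzN]; exact_mod_cast (by omega : 2 ≤ y + 1)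
  have hza : z ≤ a + 1 := by rw [hz, hzN]; push_cast; linarith
  have hz2a : z ≤ 2 * a := by linarith
  have hz1 : (1 : ℝ) ≤ z := by linarith
  have hax : a ≤ x := by
    calc a = (x : ℝ) ^ e := ha
      _ ≤ (x : ℝ) ^ (1 : ℝ) := Real.rpow_le_rpow_of_exponent_le hx1 he1
      _ = x := Real.rpow_one _
  set Dlev : ℝ := z ^ s with hDlev
  have hzD : z ≤ Dlev := by
    rw [hDlev]
    exact le_self_pow₀ hz1 (by omega)
  have hDlev0 : 0 ≤ Dlev := by positivity
  -- powers of `a`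
  have ha4s : a ^ (4 * s) = x := by
    rw [ha, ← Real.rpow_natCast, ← Real.rpow_mul hx0.le]
    have : e * ((4 * s : ℕ) : ℝ) = 1 := by
      rw [he]; push_cast; field_simp
    rw [this, Real.rpow_one]
  have ha2s : a ^ (2 * s) = (x : ℝ) ^ (1 / 2 : ℝ) := by
    rw [ha, ← Real.rpow_natCast, ← Real.rpow_mul hx0.le]
    have : e * ((2 * s : ℕ) : ℝ) = 1 / 2 := by
      rw [he]; push_cast; field_simp; ring
    rw [this]
  -- the sifted sequence of values `F(m)`, `1 ≤ m ≤ N`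
  set A := polyAPSeq F N 1 0 with hA
  set xx : ℝ := ∑ m ∈ Ioc 0 N, ((F.eval (m : ℤ) : ℤ) : ℝ) with hxx
  have hxb : ∀ m ∈ apIndex N 1 0, 0 < F.eval (m : ℤ) ∧ ((F.eval (m : ℤ) : ℤ) : ℝ) ≤ xx := by
    intro m hm
    rw [apIndex_one, mem_Ioc] at hm
    refine ⟨hFpos m, ?_⟩
    rw [hxx]
    exact single_le_sum (f := fun m : ℕ => ((F.eval (m : ℤ) : ℤ) : ℝ)) (fun n _ => by
      exact_mod_cast (hFpos n).le) (mem_Ioc.mpr hm)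
  have hdimA : HasSieveDimension A.density κ K := hdim
  have hX : 0 ≤ A.size xx := by rw [hA, polyAPSeq_size]; positivity
  have h := hFL A hdimA xx z Dlev hz2 hzD hX
  rw [hA, polyAPSeq_sifted F N 1 0 hxb, polyAPSeq_size, polyAPSeq_densityProduct, apIndex_one,
    Nat.cast_one, div_one] at h
  have hR := sum_abs_remainder_polyAPSeq_le F (N := N) (r := 0) Nat.one_pos (z := z) (D := Dlev)
    (fun p hp _ => hp.not_dvd_one) hxb
  have hR2 : ∑ m ∈ (primesProdBelow z).divisors.filter (fun m : ℕ => (m : ℝ) ≤ Dlev),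
      (polyRootCountMod ![F] m : ℝ) ≤ Dlev ^ 2 := by
    set W := (primesProdBelow z).divisors.filter (fun m : ℕ => (m : ℝ) ≤ Dlev) with hW
    calc ∑ m ∈ W, (polyRootCountMod ![F] m : ℝ) ≤ ∑ m ∈ W, Dlev := sum_le_sum fun m hm => by
          have h2 := (mem_filter.mp hm).2
          exact le_trans (by exact_mod_cast polyRootCountMod_le ![F] m) h2
      _ = #W * Dlev := by rw [sum_const, nsmul_eq_mul]
      _ ≤ Dlev * Dlev := by
          refine mul_le_mul_of_nonneg_right ?_ hDlev0
          calc (#W : ℝ) ≤ #(Icc 1 ⌊Dlev⌋₊) := by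
                exact_mod_cast card_le_card (fun m hm => by
                  rw [hW, mem_filter, Nat.mem_divisors] at hm
                  rw [mem_Icc]
                  exact ⟨Nat.pos_of_dvd_of_pos hm.1.1 (Nat.pos_of_ne_zero hm.1.2),
                    Nat.le_floor hm.2⟩)
            _ = ⌊Dlev⌋₊ := by simp
            _ ≤ Dlev := Nat.floor_le hDlev0
      _ = Dlev ^ 2 := (sq Dlev).symm
  -- the exponent `log D / log z = s`
  have hlogz : 0 < Real.log z := Real.log_pos (by linarith)
  have hsd : Real.log Dlev / Real.log z = s := by
    rw [hDlev, Real.log_pow]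
    field_simp
  rw [hsd] at h
  -- the sieve product `V(z) = ∏_{p ≤ y} (1 − ω_f(p)/p)` and its lower bound
  set V := ∏ p ∈ Nat.primesBelow ⌈z⌉₊, (1 - (polyRootCountMod ![F] p : ℝ) / p) with hV
  have hV0 : 0 ≤ V := prod_nonneg fun p _ => by
    have := rootDensity_le_one F p
    rw [rootDensity_apply] at this
    linarith
  have hVeq : V = ∏ p ∈ Nat.primesLE y, (1 - (polyRootCountMod f p : ℝ) / p) := by
    rw [hV, hz, Nat.ceil_natCast]
    change ∏ p ∈ Nat.primesLE y, (1 - (polyRootCountMod ![F] p : ℝ) / p) = _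
    exact prod_congr rfl fun p _ => by rw [hρF]
  have hy1 : (1 : ℝ) < y := by exact_mod_cast (show 1 < y by omega)
  have hlogy : 0 < Real.log y := Real.log_pos hy1
  have hlogyx : Real.log y ≤ Real.log x := Real.log_le_log (by linarith) (hya.trans hax)
  have hlogx : 0 < Real.log x := lt_of_lt_of_le hlogy hlogyx
  have hVlow : C * γk / 2 / Real.log x ^ k ≤ V := by
    rw [hVeq]
    have hLk : 0 < Real.log y ^ k := pow_pos hlogy k
    have hP : C * γk / 2 / Real.log y ^ k ≤
        ∏ p ∈ Nat.primesLE y, (1 - (polyRootCountMod f p : ℝ) / p) := by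
      rw [div_le_iff₀ hLk]
      calc C * γk / 2 ≤ Real.log y ^ k * ∏ p ∈ Nat.primesLE y, (1 - (polyRootCountMod f p : ℝ) / p) :=
            h1
        _ = (∏ p ∈ Nat.primesLE y, (1 - (polyRootCountMod f p : ℝ) / p)) * Real.log y ^ k :=
            mul_comm _ _
    refine le_trans ?_ hP
    exact div_le_div_of_nonneg_left (by positivity) hLk (pow_le_pow_left₀ hlogy.le hlogyx k)
  -- the Fundamental Lemma: `S ≥ N V/2 − D²`
  set S : ℝ := (#((Ioc 0 N).filter fun m : ℕ =>
    (F.eval (m : ℤ)).natAbs.Coprime (primesProdBelow z)) : ℝ) with hSdef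
  have hmain : (N : ℝ) * V / 2 - Dlev ^ 2 ≤ S := by
    have hab := (abs_le.mp h).1
    have hNV : (0 : ℝ) ≤ N * V := by positivity
    have hCe : CFL * N * V * Real.exp (-(s : ℝ)) ≤ N * V / 2 := by
      have := mul_le_mul_of_nonneg_left hexp_s hNV
      calc CFL * N * V * Real.exp (-(s : ℝ)) = N * V * (CFL * Real.exp (-(s : ℝ))) := by ring
        _ ≤ N * V * (1 / 2) := this
        _ = N * V / 2 := by ring
    linarith [hR.trans hR2]
  -- `D² ≤ 4^s x^{1/2}`
  have hDlev2 : Dlev ^ 2 ≤ Kf * (x : ℝ) ^ (1 / 2 : ℝ) := by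
    have h2a : Dlev ≤ (2 * a) ^ s := by
      rw [hDlev]; exact pow_le_pow_left₀ (by linarith) hz2a s
    have hsq : ((2 * a) ^ s) ^ 2 = Kf * a ^ (2 * s) := by
      rw [hKf, mul_pow, mul_pow, ← pow_mul, ← pow_mul, show (4 : ℝ) = 2 ^ 2 by norm_num, ← pow_mul]
      ring_nf
    calc Dlev ^ 2 ≤ ((2 * a) ^ s) ^ 2 := pow_le_pow_left₀ hDlev0 h2a 2
      _ = Kf * (x : ℝ) ^ (1 / 2 : ℝ) := by rw [hsq, ha2s]
  -- hence `S ≥ c C x/(log x)^k`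
  have hSlow : c * C * (x : ℝ) / Real.log x ^ k ≤ S := by
    have hlk : 0 < Real.log x ^ k := pow_pos hlogx k
    have hVl0 : 0 ≤ C * γk / 2 / Real.log x ^ k := by positivity
    have hNV : (x : ℝ) / 2 * (C * γk / 2 / Real.log x ^ k) ≤ N * V :=
      mul_le_mul (by linarith) hVlow hVl0 (Nat.cast_nonneg _)
    have e1 : (x : ℝ) / 2 * (C * γk / 2 / Real.log x ^ k) / 2 =
        2 * (c * C * x / Real.log x ^ k) := by
      rw [hc, hγk]; field_simp; ring
    have e2 : c * C * ((x : ℝ) / Real.log x ^ k) = c * C * x / Real.log x ^ k := by ring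
    linarith [hmain, hDlev2, h3]
  -- and the sifted `m` give almost-prime values at `n = m + n₀ ≤ x`
  have hcount : #((Ioc 0 N).filter fun m : ℕ =>
      (F.eval (m : ℤ)).natAbs.Coprime (primesProdBelow z)) ≤
      #((range (x + 1)).filter fun n : ℕ =>
        (∏ i, (f i).eval (n : ℤ)) ≠ 0 ∧
          Nat.IsAtMostAlmostPrime r (∏ i, (f i).eval (n : ℤ)).natAbs) := by
    refine Finset.card_le_card_of_injOn (fun m => m + n₀) (fun m hm => ?_)
      (fun m₁ _ m₂ _ h => by simpa using h)
    rw [mem_coe, mem_filter, mem_Ioc] at hm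
    obtain ⟨⟨hm0, hmN⟩, hcop⟩ := hm
    rw [mem_coe, mem_filter, mem_range]
    have hprodeq : (∏ i, (f i).eval (((m + n₀ : ℕ) : ℤ))) = F.eval (m : ℤ) := by
      rw [hFeval]; push_cast; rfl
    have hne : (F.eval (m : ℤ)).natAbs ≠ 0 := Int.natAbs_ne_zero.mpr (hFpos m).ne'
    refine ⟨?_, ?_, ?_⟩
    · show m + n₀ < x + 1
      omega
    · rw [hprodeq]; exact (hFpos m).ne'
    · rw [hprodeq]
      refine ⟨hne, ?_⟩
      -- every prime factor of `F(m)` is `≥ zN`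
      have hrough : ∀ p : ℕ, p.Prime → p ∣ (F.eval (m : ℤ)).natAbs → zN ≤ p := by
        intro p hp hpd
        rw [coprime_primesProdBelow_iff] at hcop
        by_contra hlt
        push Not at hlt
        refine hcop p (Nat.mem_primesBelow.mpr ⟨?_, hp⟩) hpd
        rw [hz, Nat.ceil_natCast]
        exact hlt
      have hpow := pow_cardFactors_le hne hrough
      -- `F(m) ≤ x^{D+1} ≤ zN^r`
      have hsz : (F.eval (m : ℤ)).natAbs ≤ x ^ (D + 1) := by
        have h1' := hsize m x hm0 (by omega)
        have hBx : (B : ℤ) ≤ x := by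
          have : (B.toNat : ℤ) = B := Int.toNat_of_nonneg hB0
          rw [← this]
          exact_mod_cast hxB
        have hBx' : B * (x : ℤ) ^ D ≤ (x : ℤ) ^ (D + 1) := by
          rw [pow_succ, mul_comm ((x : ℤ) ^ D)]
          exact mul_le_mul_of_nonneg_right hBx (by positivity)
        exact_mod_cast h1'.trans hBx'
      have hzr : x ^ (D + 1) ≤ zN ^ r := by
        have h4s : x ≤ zN ^ (4 * s) := by
          have : (x : ℝ) ≤ (zN : ℝ) ^ (4 * s) := by
            rw [← ha4s, ← hz]
            exact pow_le_pow_left₀ ha0 haz.le _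
          exact_mod_cast this
        calc x ^ (D + 1) ≤ (zN ^ (4 * s)) ^ (D + 1) := Nat.pow_le_pow_left h4s _
          _ = zN ^ r := by rw [← pow_mul, hr]
      have hfin : zN ^ Ω (F.eval (m : ℤ)).natAbs ≤ zN ^ r := hpow.trans (hsz.trans hzr)
      exact (pow_le_pow_iff_right₀ (by omega : 1 < zN)).mp hfin
  calc c * batemanHornConst f * (x : ℝ) / Real.log x ^ k = c * C * (x : ℝ) / Real.log x ^ k := by
        rw [hCdef]
    _ ≤ S := hSlow
    _ ≤ _ := by rw [hSdef]; exact_mod_cast hcount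

end BatemanHornAlmostPrimes

end Literature.NumberTheory.Sieve
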